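import Summits.NavierStokesRegularity.NavierStokesRegularity.Theses.PumpContinuation

/-!
# Line `Sketch` (ideator k = 2) for `BoundedTemperatureClosed` (stmt-NavierStokesRegularity-18303)

Skeleton owned by the line lead: closedness ⇐ LOSSY closedness + ATTAINment in the ceiling
(`closed_of_lossy_of_attain`, proved), with the two halves as registered stubs.

WARNING (lead, cycle 1): `stub_attain` contains, at the ZERO averaging datum (`mᵢ ≡ 0`, segment
`T_θ = θ·B`, amplitude rescaling `u ↦ θu`), the statement "the set of Type-I constants of
Schwartz-data `H¹⁰_df`-mild Navier–Stokes blow-ups is empty or has a positive MINIMUM" — an open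
Navier–Stokes problem; the kernel-checked reduction is landed under
`Theorems/BoundedTemperatureClosed/Negative/` (see NOTES.md of the lead). No worker is briefed on it.

UPDATE (lead c1): the TEMPERATURE FLOOR is now a theorem (`Theorems/BoundedTemperatureClosed/Negative/
TemperatureFloor.lean`, p149636: every Schwartz-data `H¹⁰_df`-mild Type-I blow-up of Navier–Stokes has
constant `≥ c_Leray > 0`; the mild blow-up time is the classical lifespan). Consequently
(`Negative/ZeroDatumFloor.lean`): at every form-zero datum `stub_lossyClosed` HOLDS
(`closure_btSet_subset_of_form_eq_zero`), while `stub_attain` there — and the crux itself there — is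
EQUIVALENT to `¬ TypeIInfimumNotAttainedNS` (the registered open statement of the disprover's negative
lemma): the LOSSY/ATTAIN split has no leverage at the obstruction; the crux as quantified is misstated
(repair on the item: `BoundedTemperatureClosedAtOne`). Stubs unchanged (no reshape can remove `¬H`).
-/

noncomputable section

open MeasureTheory Set Filter Topology Function
open Literature.Analysis.FluidPDE Literature.Analysis.FluidPDE.Tao2016

set_option linter.dupNamespace false

namespace Summit.NavierStokesRegularity.NavierStokesRegularity.Cruxes.BoundedTemperatureClosed.Sketch

/-- The segment of trilinear forms `T_θ = (1-θ)·B̃_𝒜 + θ·B`. -/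
def segForm (𝒜 : AveragingDatum) (θ : ℝ) : L2C → L2C → L2C → ℂ :=
  fun a b c => ((1 - θ : ℝ) : ℂ) * 𝒜.form a b c + ((θ : ℝ) : ℂ) * eulerForm a b c

/-- The bounded-temperature blow-up set of a `θ`-family of forms at ceiling `M` (body of the crux). -/
def btSet (T : ℝ → L2C → L2C → L2C → ℂ) (M : ℝ) : Set ℝ :=
  {θ : ℝ | θ ∈ Icc (0 : ℝ) 1 ∧
    ∃ u₀ : SchwartzMap (EuclideanSpace ℝ (Fin 3)) (EuclideanSpace ℝ (Fin 3)),
      VectorCalculus.IsDivFree ⇑u₀ ∧ ∃ S : ℝ, 0 < S ∧ ∃ u : ℝ → L2C,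
        IsMildSolutionFor (T θ) (schwartzL2 u₀) (Ico 0 S) u ∧
        (∀ t ∈ Ico 0 S, eLpNorm (u t) ⊤ volume ≤ ENNReal.ofReal (M / Real.sqrt (S - t))) ∧
        ¬ ∃ S' : ℝ, S < S' ∧ ∃ v : ℝ → L2C,
          IsMildSolutionFor (T θ) (schwartzL2 u₀) (Ico 0 S') v ∧ ∀ t ∈ Ico 0 S, v t = u t}

/-- The crux read through `btSet`/`segForm` (definitional). -/
theorem crux_iff :
    Theses.PumpContinuation.BoundedTemperatureClosed ↔
      ∀ 𝒜 : AveragingDatum, 𝒜.IsSymmetric → 𝒜.HasCancellation →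
        ∀ M : ℝ, IsClosed (btSet (segForm 𝒜) M) :=
  Iff.rfl

/-- **Lossy closedness**: limits of `M`-witness parameters are `(M+η)`-witness parameters for
every `η > 0` (the compactness half). -/
def LossyClosed : Prop :=
  ∀ 𝒜 : AveragingDatum, 𝒜.IsSymmetric → 𝒜.HasCancellation →
    ∀ M η : ℝ, 0 < η → closure (btSet (segForm 𝒜) M) ⊆ btSet (segForm 𝒜) (M + η)

/-- **Attainment in the ceiling at a fixed operator**: a parameter carrying `(M+η)`-witnesses for
every `η > 0` carries an `M`-witness. -/
def Attain : Prop :=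
  ∀ 𝒜 : AveragingDatum, 𝒜.IsSymmetric → 𝒜.HasCancellation →
    ∀ M θ : ℝ, (∀ η : ℝ, 0 < η → θ ∈ btSet (segForm 𝒜) (M + η)) → θ ∈ btSet (segForm 𝒜) M

/-- Registered stub: lossy closedness (compactness of bounded-temperature blow-ups along the segment). -/
theorem stub_lossyClosed : LossyClosed := by
  sorry

/-- Registered stub: attainment of the infimal ceiling at a fixed operator (contains an open
Navier–Stokes statement at the zero datum — see the file header). -/
theorem stub_attain : Attain := by
  sorry

/-- **PROVED reduction.** `LossyClosed → Attain → BoundedTemperatureClosed`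
(`closure S_M ⊆ ⋂_η S_{M+η} ⊆ S_M`). -/
theorem closed_of_lossy_of_attain (hL : LossyClosed) (hA : Attain) :
    ∀ 𝒜 : AveragingDatum, 𝒜.IsSymmetric → 𝒜.HasCancellation →
      ∀ M : ℝ, IsClosed (btSet (segForm 𝒜) M) := by
  intro 𝒜 hs hc M
  refine isClosed_of_closure_subset fun θ hθ => ?_
  exact hA 𝒜 hs hc M θ fun η hη => hL 𝒜 hs hc M η hη hθ

/-- **Composition**: the crux by name, modulo the two registered stubs. -/
theorem BoundedTemperatureClosed_of : Theses.PumpContinuation.BoundedTemperatureClosed :=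
  closed_of_lossy_of_attain stub_lossyClosed stub_attain

end Summit.NavierStokesRegularity.NavierStokesRegularity.Cruxes.BoundedTemperatureClosed.Sketch

end
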